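import Mathlib.MeasureTheory.Constructions.Pi
import Mathlib.MeasureTheory.Measure.Lebesgue.Basic
import Mathlib.Algebra.Order.Floor.Defs
import HarnessLib

/-!
# Dyadic cubes in `ℝⁿ` (the combinatorial half of the Calderón–Zygmund cube decomposition)

The half-open dyadic cubes `Q_{k,m} = ∏_j [m_j 2^{-k}, (m_j+1) 2^{-k})` of generation `k` in
`ℝⁿ = (ι → ℝ)`: they are measurable boxes of Lebesgue measure `2^{-kn}`, every point lies in
exactly one cube of each generation (`mem_dyadicCube_index`, `index_unique`), each cube lies in its
parent of the previous generation (`dyadicCube_subset_parent`), and two dyadic cubes are nested or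
disjoint (`dyadicCube_subset_or_disjoint_of_le`). This is the bookkeeping behind
Gilbarg–Trudinger's cube decomposition (§9.2, (9.16)–(9.20)) used in the Krylov–Safonov weak
Harnack inequality (Thm. 9.22, via Lemma 9.23), itself needed for the Evans–Krylov step of
`Literature.Geometry.Riemannian.gurskyViaclovsky_pathClosed_weighted_four`.

## References

* D. Gilbarg, N. S. Trudinger, *Elliptic Partial Differential Equations of Second Order* (2001),
  §9.2 (cube decomposition). [GilbargTrudinger2001]
-/

noncomputable section

open Set MeasureTheory

namespace Literature.MeasureTheory.Covering.Dyadic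

variable {ι : Type*} [Fintype ι]

/-- The dyadic cube of generation `k` and index `m`: `∏_j [m_j/2^k, (m_j+1)/2^k)`.
[cite: GilbargTrudinger2001, §9.2] -/
def dyadicCube (k : ℕ) (m : ι → ℤ) : Set (ι → ℝ) :=
  Set.pi univ fun j ↦ Ico ((m j : ℝ) / 2 ^ k) ((m j + 1 : ℝ) / 2 ^ k)

omit [Fintype ι] in
/-- Membership in a dyadic cube, coordinatewise. [folklore] -/
theorem mem_dyadicCube {k : ℕ} {m : ι → ℤ} {x : ι → ℝ} :
    x ∈ dyadicCube k m ↔ ∀ j, (m j : ℝ) / 2 ^ k ≤ x j ∧ x j < (m j + 1 : ℝ) / 2 ^ k := by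
  simp [dyadicCube, mem_pi, mem_Ico]

omit [Fintype ι] in
/-- Membership through the scaled coordinates: `x ∈ Q_{k,m} ↔ ∀ j, m_j ≤ 2^k x_j < m_j + 1`.
[folklore] -/
theorem mem_dyadicCube_iff_floor {k : ℕ} {m : ι → ℤ} {x : ι → ℝ} :
    x ∈ dyadicCube k m ↔ ∀ j, (m j : ℝ) ≤ x j * 2 ^ k ∧ x j * 2 ^ k < m j + 1 := by
  rw [mem_dyadicCube]
  have h2 : (0 : ℝ) < 2 ^ k := by positivity
  refine forall_congr' fun j ↦ ?_
  rw [div_le_iff₀ h2, lt_div_iff₀ h2]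

/-- **The index of the generation-`k` cube containing `x`**: `m_j = ⌊2^k x_j⌋`. [folklore] -/
def index (k : ℕ) (x : ι → ℝ) : ι → ℤ := fun j ↦ ⌊x j * 2 ^ k⌋

omit [Fintype ι] in
/-- **Every point lies in the dyadic cube of its index.** [folklore] -/
theorem mem_dyadicCube_index (k : ℕ) (x : ι → ℝ) : x ∈ dyadicCube k (index k x) := by
  rw [mem_dyadicCube_iff_floor]
  exact fun j ↦ ⟨Int.floor_le _, Int.lt_floor_add_one _⟩

omit [Fintype ι] in
/-- **Uniqueness**: the generation-`k` cube containing `x` is the one of its index. [folklore] -/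
theorem index_unique {k : ℕ} {m : ι → ℤ} {x : ι → ℝ} (hx : x ∈ dyadicCube k m) :
    m = index k x := by
  rw [mem_dyadicCube_iff_floor] at hx
  funext j
  exact ((Int.floor_eq_iff).2 ⟨(hx j).1, (hx j).2⟩).symm

omit [Fintype ι] in
/-- Two cubes of the same generation are equal or disjoint. [folklore] -/
theorem dyadicCube_eq_or_disjoint (k : ℕ) (m m' : ι → ℤ) :
    m = m' ∨ Disjoint (dyadicCube k m) (dyadicCube k m') := by
  by_cases h : m = m'
  · exact Or.inl h
  · refine Or.inr (disjoint_left.2 fun x hx hx' ↦ h ?_)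
    rw [index_unique hx, index_unique hx']

omit [Fintype ι] in
/-- Dyadic cubes are measurable. [folklore] -/
theorem measurableSet_dyadicCube [Countable ι] (k : ℕ) (m : ι → ℤ) :
    MeasurableSet (dyadicCube (ι := ι) k m) :=
  MeasurableSet.univ_pi fun _ ↦ measurableSet_Ico

/-- **The Lebesgue measure of a dyadic cube** of generation `k` is `(2^{-k})ⁿ`. [folklore] -/
theorem volume_dyadicCube (k : ℕ) (m : ι → ℤ) :
    volume (dyadicCube k m) = ENNReal.ofReal ((2 ^ k)⁻¹) ^ Fintype.card ι := by
  classical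
  rw [dyadicCube, volume_pi_pi]
  simp only [Real.volume_Ico]
  have h : ∀ j : ι, ((m j + 1 : ℝ) / 2 ^ k - (m j : ℝ) / 2 ^ k) = (2 ^ k)⁻¹ := fun j ↦ by
    field_simp; ring
  simp only [h, Finset.prod_const, Finset.card_univ]

/-! ### Parents and nesting -/

/-- The index of the parent cube (generation `k`) of a generation-`k+1` cube: `⌊m_j/2⌋`.
[folklore] -/
def parentIndex (m : ι → ℤ) : ι → ℤ := fun j ↦ m j / 2

omit [Fintype ι] in
/-- **Each dyadic cube lies in its parent.** [cite: GilbargTrudinger2001, §9.2] -/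
theorem dyadicCube_subset_parent (k : ℕ) (m : ι → ℤ) :
    dyadicCube (k + 1) m ⊆ dyadicCube k (parentIndex m) := by
  intro x hx
  rw [mem_dyadicCube_iff_floor] at hx ⊢
  intro j
  obtain ⟨h1, h2⟩ := hx j
  have hdiv : (m j / 2 : ℤ) * 2 ≤ m j := Int.ediv_mul_le (m j) two_ne_zero
  have hlt : m j < (m j / 2 + 1) * 2 := by
    have := Int.lt_ediv_add_one_mul_self (m j) (by norm_num : (0 : ℤ) < 2)
    linarith
  have hdiv' : ((m j / 2 : ℤ) : ℝ) * 2 ≤ m j := by exact_mod_cast hdiv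
  have hlt' : (m j : ℝ) + 1 ≤ ((m j / 2 : ℤ) : ℝ) * 2 + 2 := by
    have : m j + 1 ≤ (m j / 2 + 1) * 2 := hlt
    have := (Int.cast_le (R := ℝ)).2 this
    push_cast at this
    linarith
  simp only [parentIndex, pow_succ] at *
  constructor
  · nlinarith
  · nlinarith

omit [Fintype ι] in
/-- The ancestor of generation `k` of a generation-`k + l` cube (iterated parent). [folklore] -/
theorem dyadicCube_subset_ancestor (k l : ℕ) (m : ι → ℤ) :
    ∃ m' : ι → ℤ, dyadicCube (k + l) m ⊆ dyadicCube k m' := by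
  induction l generalizing m with
  | zero => exact ⟨m, subset_rfl⟩
  | succ l ih =>
    obtain ⟨m', hm'⟩ := ih (parentIndex m)
    exact ⟨m', (dyadicCube_subset_parent (k + l) m).trans hm'⟩

omit [Fintype ι] in
/-- **Two dyadic cubes are nested or disjoint**: a cube of generation `k' ≥ k` is either contained
in or disjoint from any cube of generation `k`. [cite: GilbargTrudinger2001, §9.2] -/
theorem dyadicCube_subset_or_disjoint_of_le {k k' : ℕ} (hkk' : k ≤ k') (m : ι → ℤ)
    (m' : ι → ℤ) :
    dyadicCube k' m' ⊆ dyadicCube k m ∨ Disjoint (dyadicCube k' m') (dyadicCube k m) := by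
  obtain ⟨l, rfl⟩ := Nat.exists_eq_add_of_le hkk'
  obtain ⟨m'', hsub⟩ := dyadicCube_subset_ancestor k l m'
  rcases dyadicCube_eq_or_disjoint k m'' m with h | h
  · left; rwa [h] at hsub
  · right; exact Disjoint.mono_left hsub h

omit [Fintype ι] in
/-- **Dyadic cubes are small**: points of a generation-`k` cube differ by less than `2^{-k}` in each
coordinate. [folklore] -/
theorem sub_lt_of_mem_dyadicCube {k : ℕ} {m : ι → ℤ} {x y : ι → ℝ} (hx : x ∈ dyadicCube k m)
    (hy : y ∈ dyadicCube k m) (j : ι) : |x j - y j| < (2 ^ k)⁻¹ := by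
  rw [mem_dyadicCube] at hx hy
  obtain ⟨hx1, hx2⟩ := hx j
  obtain ⟨hy1, hy2⟩ := hy j
  have h2 : (0 : ℝ) < 2 ^ k := by positivity
  rw [abs_sub_lt_iff]
  have hw : ((m j + 1 : ℝ) / 2 ^ k) - (m j : ℝ) / 2 ^ k = (2 ^ k)⁻¹ := by field_simp; ring
  constructor <;> linarith

end Literature.MeasureTheory.Covering.Dyadic

end
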